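import Summits.CriticalPhenomena.PercolationContinuityZ3.Theorems.SahiMasterFamilyKahnModule

/-!
# Kahn's third-order inequality under module extensions — the joint disjunction `(B ∨ V, C ∨ V)`
# (lineage `prim-master-conj`, gen 55; `--supports stmt-CriticalPhenomena-4575`)

Continues `…SahiMasterFamilyKahnModule` (same setting and notation).  Nothing here asserts Kahn's Conjecture 5.

`kahnPair_or_or`: if `(g,h)` is a Kahn pair on `X` (indicators; Harris on `X` is not even needed here) and `v` is a monotone
indicator on the Harris space `Y`,
then `(bor g v, bor h v)` is a Kahn pair on `X × Y`.  Proof.  On `V` both functions are `1`, so the on-fibre contribution is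
`s · a(y)` with the constant `s = 2 − b* − c* − κ* = (1−v̄)σ`, `σ = (1−v̄)(1−b)(1−c) + (1−d)`; off `V` it is
`Φ_off(y) = E_X(F_y ψ_off)`, `ψ_off = 2gh − c*g − b*h − κ*`.  The pointwise four-region identity
`S·(ψ_off + v̄σ) − σ·ψ_{BC} = v̄·[(1−b)(c−d)·g(1−h) + (1−c)(b−d)·(1−g)h + (1−d)(2−b−c)·(1−g)(1−h)] ≥ 0`
(`S = (1−b)(1−c) + (1−d)`, `ψ_{BC}` the Kahn function of `(g,h)`) and the fibre Kahn inequality give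
`Φ_off + v̄σ·a ≥ 0`, whence `E₃ ≥ σ·E_Y(a·(v − v̄)) ≥ 0` by Harris on `Y`.  The degenerate case `S = 0` (then `g = h = 1`
almost surely) is treated separately.  The certificate (`θ ≡ v̄s`, multiplier `σ/S`) is the lineage's cell-transfer certificate
for the section pattern `(B,⊤),(C,⊤)` (gen 55).  [this work]
-/

open Finset
open scoped BigOperators

namespace Summit.CriticalPhenomena.PercolationContinuityZ3.Theorems.SahiKahnModule

variable {X Y : Type*} [Fintype X] [Fintype Y] [Preorder X] [Preorder Y]

omit [Preorder X] in
/-- Almost-sure identity: if the indicator `u` has expectation `1` under the probability weight `w`, then `E(φ·u) = E φ`.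
[this work] -/
theorem ex_mul_eq_of_ex_eq_one {w : X → ℝ} (hw : IsProbWeight w) {u : X → ℝ} (hu : IsIndicator u) (h1 : ex w u = 1)
    (φ : X → ℝ) : ex w (fun x => φ x * u x) = ex w φ := by
  have hz : ∀ x, w x * (1 - u x) = 0 := by
    have hs : ∑ x, w x * (1 - u x) = 0 := by
      have : ex w (fun x => (1 : ℝ) - u x) = 1 - 1 := by
        rw [show (fun x => (1:ℝ) - u x) = (fun _ => (1:ℝ)) - u from rfl, ex_sub, ex_const hw, h1]
      simpa [ex] using this
    have hnn : ∀ x ∈ (univ : Finset X), 0 ≤ w x * (1 - u x) := fun x _ => mul_nonneg (hw.nonneg x) (sub_nonneg.2 (hu.le_one x))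
    exact fun x => (sum_eq_zero_iff_of_nonneg hnn).1 hs x (mem_univ x)
  have : ex w φ - ex w (fun x => φ x * u x) = 0 := by
    rw [← ex_sub]; unfold ex
    exact sum_eq_zero fun x _ => by
      have := hz x; simp only [Pi.sub_apply]
      linear_combination (φ x) * this
  linarith

omit [Preorder X] [Preorder Y] in
/-- `E(F · bor g v · bor h v) = E_Y( v·a + (1−v)·D )` for an indicator `v`. [this work] -/
theorem ex_F_bor_bor (w : X → ℝ) (w' : Y → ℝ) (F : X × Y → ℝ) (g h : X → ℝ) {v : Y → ℝ} (hv : IsIndicator v) :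
    ex (prodW w w') (F * bor g v * bor h v) =
      ex w' (fun y => v y * ex w (fun x => F (x, y)) + (1 - v y) * ex w ((fun x => F (x, y)) * g * h)) := by
  rw [ex_prodW]; refine congrArg _ (funext fun y => ?_)
  unfold ex; rw [mul_sum, mul_sum, ← sum_add_distrib]
  exact sum_congr rfl fun x _ => by
    simp only [Pi.mul_apply, bor]
    linear_combination (w x * F (x, y) * (1 - g x - h x + g x * h x)) * hv.mul_self y

omit [Preorder X] [Preorder Y] in
/-- `E(bor g v · bor h v) = v̄ + (1−v̄)·E_X(g h)` for an indicator `v` (probability weights). [this work] -/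
theorem ex_bor_bor (w : X → ℝ) (w' : Y → ℝ) (hw : IsProbWeight w) (hw' : IsProbWeight w') (g h : X → ℝ) {v : Y → ℝ}
    (hv : IsIndicator v) : ex (prodW w w') (bor g v * bor h v) = ex w' v + (1 - ex w' v) * ex w (g * h) := by
  rw [ex_prodW]
  have : (fun y => ex w fun x => (bor g v * bor h v : X × Y → ℝ) (x, y)) =
      (fun y => (1 - ex w (g * h)) * v y) + fun _ => ex w (g * h) := by
    funext y; simp only [Pi.add_apply]
    have e : (fun x => (bor g v * bor h v : X × Y → ℝ) (x, y)) = (fun x => (1 - v y) * (g * h) x) + fun _ => v y := by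
      funext x; simp only [bor, Pi.add_apply, Pi.mul_apply]
      linear_combination (1 - g x - h x + g x * h x) * hv.mul_self y
    rw [e, ex_add, ex_smul, ex_const hw]; ring
  rw [this, ex_add, ex_smul, ex_const hw']; ring

omit [Fintype X] [Preorder X] [Preorder Y] in
/-- Linearity bookkeeping for `kahnPair_or_or`: the functional in fibre form. [this work] -/
theorem ex_lin_or_or (w' : Y → ℝ) (v D G H a : Y → ℝ) (bs cs ds : ℝ) :
    2 * ex w' (fun y => v y * a y + (1 - v y) * D y) - ex w' (fun y => v y * a y + (1 - v y) * G y) * cs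
        - ex w' (fun y => v y * a y + (1 - v y) * H y) * bs - ds * ex w' a + ex w' a * bs * cs =
      ex w' (fun y => v y * ((2 - bs - cs - ds + bs * cs) * a y)
        + (1 - v y) * (2 * D y - cs * G y - bs * H y - (ds - bs * cs) * a y)) := by
  simp only [ex, mul_sum, sum_mul, ← sum_sub_distrib, ← sum_add_distrib]
  exact sum_congr rfl fun y _ => by ring

omit [Preorder X] in
/-- Linearity bookkeeping on `X`: the four-region combination integrated against `f`. [this work] -/
theorem ex_lin_regions (w : X → ℝ) (f g h : X → ℝ) (S σ vb b c d bs cs ks : ℝ) :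
    S * (2 * ex w (f * g * h) - cs * ex w (f * g) - bs * ex w (f * h) - ks * ex w f + vb * σ * ex w f)
        - σ * (2 * ex w (f * g * h) - ex w (f * g) * c - ex w (f * h) * b - (d - b * c) * ex w f) =
      ex w (fun x => f x * (S * (2 * g x * h x - cs * g x - bs * h x - ks + vb * σ)
        - σ * (2 * g x * h x - c * g x - b * h x - (d - b * c)))) := by
  simp only [ex, mul_sum, sum_mul, ← sum_sub_distrib, ← sum_add_distrib, Pi.mul_apply]
  exact sum_congr rfl fun x _ => by ring

/-- **The four-region inequality** behind `kahnPair_or_or`: for `g, h ∈ {0,1}` and admissible parameters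
(`b, c ≤ 1`, `d ≤ b`, `d ≤ c`, `0 ≤ v̄`), with `P = (1−b)(1−c)`, `Q = 1−d`, `S = P + Q`, `σ = (1−v̄)P + Q`,
`S·(ψ_off + v̄σ) − σ·ψ_{BC} = v̄·[(1−b)(c−d)g(1−h) + (1−c)(b−d)(1−g)h + (1−d)(2−b−c)(1−g)(1−h)] ≥ 0`. [this work] -/
theorem regions_nonneg (b c d vb g h : ℝ) (hg : g = 0 ∨ g = 1) (hh : h = 0 ∨ h = 1) (hb1 : b ≤ 1) (hc1 : c ≤ 1)
    (hdb : d ≤ b) (hdc : d ≤ c) (hvb : 0 ≤ vb) :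
    0 ≤ ((1 - b) * (1 - c) + (1 - d)) * (2 * g * h - (vb + (1 - vb) * c) * g - (vb + (1 - vb) * b) * h
        - (1 - vb) * (vb * ((1 - b) * (1 - c)) + (d - b * c)) + vb * ((1 - vb) * ((1 - b) * (1 - c)) + (1 - d)))
      - ((1 - vb) * ((1 - b) * (1 - c)) + (1 - d)) * (2 * g * h - c * g - b * h - (d - b * c)) := by
  rcases hg with rfl | rfl <;> rcases hh with rfl | rfl
  · linarith [mul_nonneg hvb (mul_nonneg (by linarith : (0:ℝ) ≤ 1 - d) (by linarith : (0:ℝ) ≤ 2 - b - c))]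
  · linarith [mul_nonneg hvb (mul_nonneg (sub_nonneg.2 hc1) (sub_nonneg.2 hdb))]
  · linarith [mul_nonneg hvb (mul_nonneg (sub_nonneg.2 hb1) (sub_nonneg.2 hdc))]
  · linarith

/-- **Module extension `(B,C) ↦ (B ∨ V, C ∨ V)`.**  If `(g,h)` is a Kahn pair on the Harris space `X` and `v` a monotone
indicator on the Harris space `Y`, then `(bor g v, bor h v)` is a Kahn pair on `X × Y`:
`E₃ ≥ σ · E_Y(a·(v − v̄)) ≥ 0`. [this work] -/
theorem kahnPair_or_or {w : X → ℝ} {w' : Y → ℝ} (hw : IsProbWeight w) (hw' : IsProbWeight w')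
    (hY : IsHarris w') {g h : X → ℝ} {v : Y → ℝ} (hg : IsIndicator g) (hh : IsIndicator h)
    (hv : IsIndicator v) (hvm : Monotone v) (hK : KahnPair w g h) :
    KahnPair (prodW w w') (bor g v) (bor h v) := by
  intro F hF hF0
  set a : Y → ℝ := fun y => ex w (fun x => F (x, y)) with ha
  set D : Y → ℝ := fun y => ex w ((fun x => F (x, y)) * g * h) with hD
  set G : Y → ℝ := fun y => ex w ((fun x => F (x, y)) * g) with hG
  set H : Y → ℝ := fun y => ex w ((fun x => F (x, y)) * h) with hH
  have hb := ex_indicator_mem hw hg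
  have hc := ex_indicator_mem hw hh
  have hvb := ex_indicator_mem hw' hv
  have hdb : ex w (g * h) ≤ ex w g :=
    ex_mono hw.nonneg fun x => by simpa using mul_le_of_le_one_right (hg.nonneg x) (hh.le_one x)
  have hdc : ex w (g * h) ≤ ex w h :=
    ex_mono hw.nonneg fun x => by simpa using mul_le_of_le_one_left (hh.nonneg x) (hg.le_one x)
  have hd1 : ex w (g * h) ≤ 1 := hdb.trans hb.2
  -- abbreviations for the parameters (plain reals)
  obtain ⟨b, hb'⟩ : ∃ b : ℝ, b = ex w g := ⟨_, rfl⟩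
  obtain ⟨c, hc'⟩ : ∃ c : ℝ, c = ex w h := ⟨_, rfl⟩
  obtain ⟨d, hd'⟩ : ∃ d : ℝ, d = ex w (g * h) := ⟨_, rfl⟩
  obtain ⟨vb, hvb'⟩ : ∃ vb : ℝ, vb = ex w' v := ⟨_, rfl⟩
  rw [← hb'] at hb hdb; rw [← hc'] at hc hdc; rw [← hd'] at hdb hdc hd1; rw [← hvb'] at hvb
  set P : ℝ := (1 - b) * (1 - c) with hP
  set Q : ℝ := 1 - d with hQ
  set S : ℝ := P + Q with hS
  set σ : ℝ := (1 - vb) * P + Q with hσ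
  have hP0 : 0 ≤ P := mul_nonneg (sub_nonneg.2 hb.2) (sub_nonneg.2 hc.2)
  have hQ0 : 0 ≤ Q := sub_nonneg.2 hd1
  have hσ0 : 0 ≤ σ := add_nonneg (mul_nonneg (sub_nonneg.2 hvb.2) hP0) hQ0
  -- fibre identities and the functional in fibre form
  have e1 := ex_F_bor_bor w w' F g h hv
  have e2 := ex_F_bor w w' F g v
  have e3 := ex_F_bor w w' F h v
  have e4 := ex_bor w w' hw hw' g v
  have e5 := ex_bor w w' hw hw' h v
  have e6 := ex_bor_bor w w' hw hw' g h hv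
  have e7 : ex (prodW w w') F = ex w' a := ex_prodW _ _ _
  have key : kahnK (prodW w w') F (bor g v) (bor h v) = ex w' (fun y => v y * ((1 - vb) * σ * a y)
      + (1 - v y) * (2 * D y - (vb + (1 - vb) * c) * G y - (vb + (1 - vb) * b) * H y
        - (1 - vb) * (vb * P + (d - b * c)) * a y)) := by
    unfold kahnK; rw [e1, e2, e3, e4, e5, e6, e7, ← hb', ← hc', ← hd', ← hvb', ex_lin_or_or]
    refine congrArg _ (funext fun y => ?_); simp only [hσ, hP, hQ]; ring
  -- the off-fibre inequality  Φ_off(y) + v̄σ·a(y) ≥ 0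
  have off_ge : ∀ y, 0 ≤ 2 * D y - (vb + (1 - vb) * c) * G y - (vb + (1 - vb) * b) * H y
      - (1 - vb) * (vb * P + (d - b * c)) * a y + vb * σ * a y := by
    intro y
    have ihy : 0 ≤ 2 * D y - G y * c - H y * b - (d - b * c) * a y := by
      have := hK _ (monotone_fibre_left hF y) fun x => hF0 (x, y); unfold kahnK at this
      simp only [hD, hG, hH, ha, hb', hc', hd']; linarith
    have h0 : 0 ≤ ex w (fun x => (fun x => F (x, y)) x * (S * (2 * g x * h x - (vb + (1 - vb) * c) * g x
        - (vb + (1 - vb) * b) * h x - (1 - vb) * (vb * P + (d - b * c)) + vb * σ)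
        - σ * (2 * g x * h x - c * g x - b * h x - (d - b * c)))) :=
      ex_nonneg hw.nonneg fun x => mul_nonneg (hF0 (x, y)) (by
        simp only [hS, hσ, hP, hQ]; exact regions_nonneg b c d vb (g x) (h x) (hg x) (hh x) hb.2 hc.2 hdb hdc hvb.1)
    rw [← ex_lin_regions] at h0
    have reg' : σ * (2 * D y - G y * c - H y * b - (d - b * c) * a y) ≤ S * (2 * D y - (vb + (1 - vb) * c) * G y
        - (vb + (1 - vb) * b) * H y - (1 - vb) * (vb * P + (d - b * c)) * a y + vb * σ * a y) := by
      simp only [hD, hG, hH, ha]; linarith [h0]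
    by_cases hS0 : S = 0
    · -- degenerate: d = 1, hence b = c = 1, g = h = 1 almost surely, Φ_off = 0 and σ = 0
      have hQ0' : Q = 0 := by linarith [hP0, hQ0]
      have hd_one : d = 1 := by simp only [hQ] at hQ0'; linarith
      have hb_one : b = 1 := le_antisymm hb.2 (hd_one ▸ hdb)
      have hc_one : c = 1 := le_antisymm hc.2 (hd_one ▸ hdc)
      have hP1 : P = 0 := by simp only [hP, hb_one, hc_one]; ring
      have hσ1 : σ = 0 := by simp only [hσ, hP1, hQ0']; ring
      have eG : G y = a y := by
        simp only [hG, ha]; exact ex_mul_eq_of_ex_eq_one hw hg (by rw [← hb', hb_one]) _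
      have eH : H y = a y := by
        simp only [hH, ha]; exact ex_mul_eq_of_ex_eq_one hw hh (by rw [← hc', hc_one]) _
      have eD : D y = a y := by
        simp only [hD, ha]
        rw [show ((fun x => F (x, y)) * g * h) = fun x => F (x, y) * ((g * h) x) from by
          funext x; simp only [Pi.mul_apply]; ring]
        exact ex_mul_eq_of_ex_eq_one hw (hg.mul hh) (by rw [← hd', hd_one]) _
      rw [eG, eH, eD, hσ1, hP1, hd_one, hb_one, hc_one]; linarith
    · have hSpos : 0 < S := lt_of_le_of_ne (add_nonneg hP0 hQ0) (Ne.symm hS0)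
      have := mul_nonneg hσ0 ihy
      exact (mul_nonneg_iff_of_pos_left hSpos).1 (by linarith [reg'])
  -- Harris on Y for (a, v) and assembly
  have am : Monotone a := monotone_ex_fibre hw.nonneg hF
  have cov := hY.ex_mul_sub_nonneg am hvm
  rw [← hvb'] at cov
  rw [key]
  calc (0:ℝ) ≤ σ * ex w' (fun y => a y * (v y - vb)) := mul_nonneg hσ0 cov
    _ = ex w' (fun y => v y * ((1 - vb) * (σ * a y)) - (1 - v y) * (vb * (σ * a y))) := by
        rw [ex_lin_cov, ← ex_smul]; refine congrArg _ (funext fun y => ?_); ring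
    _ ≤ _ := ex_mono hw'.nonneg fun y => by linarith [mul_nonneg (sub_nonneg.2 (hv.le_one y)) (off_ge y)]

end Summit.CriticalPhenomena.PercolationContinuityZ3.Theorems.SahiKahnModule
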